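import Mathlib
import Summits.Ventures.PercRepro2.SepSplitRule

/-!
# Gluing at a general separator, VI: the EQUALITY LOCUS of row 2′TRI at a split (blind cell
PercRepro2, mine-2 g48, 2026-08-29; `conjectures/MINE-2.md` M2-98)

Six times the pairing `Σ_p l(p) h(p)` of the identity `typedCount_eq_sepSplit` is the pairing of the
far counts with the `S₃`-orbit sums of the root counts (`six_mul_sum_eq_sum_orbitG`); the inert
factor is positive (`typedCount_one_pos`: a typed set with `τ ≤ 3` always has a typed colouring).
Hence, under the rule's hypothesis (the realised orbit sums nonnegative), **the typed count vanishes
exactly when every realised orbit sum vanishes** (`typedCount_eq_zero_iff_of_sepSplit`) — the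
equality locus of row 2′TRI at any split of the marks across any separator, read on the root side;
and with no sign hypothesis at all, vanishing realised orbit sums force a vanishing count
(`typedCount_eq_zero_of_sepSplit_realised_zero`).  Own work; standard axioms.
-/

namespace Summit.Ventures.PercRepro2

open UnionCluster

namespace CovForm

namespace RootBridge

open OneTyped TypedA3 Untouched TypedFactor Separated

/-! ## The abstract vanishing criterion -/

section Abstract

variable {R : Type*} [Field R] [LinearOrder R] [IsStrictOrderedRing R]

omit [LinearOrder R] [IsStrictOrderedRing R] in
/-- Six times the pairing of a permutation-invariant weight with `h` is the pairing with the orbit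
sums of `h`. -/
lemma six_mul_sum_eq_sum_orbitG {P : Type*} [Fintype P] (l h : P × P × P → R)
    (h12 : (∑ p : P × P × P, l p * h (p.2.1, p.1, p.2.2)) = ∑ p : P × P × P, l p * h p)
    (h23 : (∑ p : P × P × P, l p * h (p.1, p.2.2, p.2.1)) = ∑ p : P × P × P, l p * h p)
    (h13 : (∑ p : P × P × P, l p * h (p.2.2, p.2.1, p.1)) = ∑ p : P × P × P, l p * h p)
    (hc : (∑ p : P × P × P, l p * h (p.2.1, p.2.2, p.1)) = ∑ p : P × P × P, l p * h p)
    (hc' : (∑ p : P × P × P, l p * h (p.2.2, p.1, p.2.1)) = ∑ p : P × P × P, l p * h p) :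
    (6 : R) * (∑ p : P × P × P, l p * h p) = ∑ p : P × P × P, l p * orbitSumG h p := by
  unfold orbitSumG
  simp only [mul_add, Finset.sum_add_distrib]
  rw [h12, h23, h13, hc, hc']
  ring

/-- **The abstract vanishing criterion**: with a nonnegative permutation-invariant weight and
nonnegative orbit sums wherever the weight is nonzero, the pairing vanishes exactly when every
orbit sum carrying weight vanishes. -/
theorem sum_eq_zero_iff_of_orbit_sumsG {P : Type*} [Fintype P] (l h : P × P × P → R)
    (hl : ∀ p, 0 ≤ l p)
    (h12 : (∑ p : P × P × P, l p * h (p.2.1, p.1, p.2.2)) = ∑ p : P × P × P, l p * h p)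
    (h23 : (∑ p : P × P × P, l p * h (p.1, p.2.2, p.2.1)) = ∑ p : P × P × P, l p * h p)
    (h13 : (∑ p : P × P × P, l p * h (p.2.2, p.2.1, p.1)) = ∑ p : P × P × P, l p * h p)
    (hc : (∑ p : P × P × P, l p * h (p.2.1, p.2.2, p.1)) = ∑ p : P × P × P, l p * h p)
    (hc' : (∑ p : P × P × P, l p * h (p.2.2, p.1, p.2.1)) = ∑ p : P × P × P, l p * h p)
    (hH : ∀ p, l p ≠ 0 → 0 ≤ orbitSumG h p) :
    (∑ p : P × P × P, l p * h p) = 0 ↔ ∀ p, l p ≠ 0 → orbitSumG h p = 0 := by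
  have h6 := six_mul_sum_eq_sum_orbitG l h h12 h23 h13 hc hc'
  have hterm : ∀ p ∈ (Finset.univ : Finset (P × P × P)), 0 ≤ l p * orbitSumG h p := by
    intro p _
    by_cases hz : l p = 0
    · rw [hz, zero_mul]
    · exact mul_nonneg (hl p) (hH p hz)
  constructor
  · intro h0 p hp
    have h0' : (∑ p : P × P × P, l p * orbitSumG h p) = 0 := by
      rw [← h6, h0, mul_zero]
    have := (Finset.sum_eq_zero_iff_of_nonneg hterm).mp h0' p (Finset.mem_univ p)
    rcases mul_eq_zero.mp this with h | h
    · exact absurd h hp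
    · exact h
  · intro hz
    have h0' : (∑ p : P × P × P, l p * orbitSumG h p) = 0 := by
      refine Finset.sum_eq_zero fun p _ => ?_
      by_cases hp : l p = 0
      · rw [hp, zero_mul]
      · rw [hz p hp, mul_zero]
    rw [← h6] at h0'
    rcases mul_eq_zero.mp h0' with h | h
    · norm_num at h
    · exact h

/-- With no sign hypothesis: vanishing orbit sums wherever the weight is nonzero force a vanishing
pairing. -/
theorem sum_eq_zero_of_orbit_sums_zeroG {P : Type*} [Fintype P] (l h : P × P × P → R)
    (h12 : (∑ p : P × P × P, l p * h (p.2.1, p.1, p.2.2)) = ∑ p : P × P × P, l p * h p)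
    (h23 : (∑ p : P × P × P, l p * h (p.1, p.2.2, p.2.1)) = ∑ p : P × P × P, l p * h p)
    (h13 : (∑ p : P × P × P, l p * h (p.2.2, p.2.1, p.1)) = ∑ p : P × P × P, l p * h p)
    (hc : (∑ p : P × P × P, l p * h (p.2.1, p.2.2, p.1)) = ∑ p : P × P × P, l p * h p)
    (hc' : (∑ p : P × P × P, l p * h (p.2.2, p.1, p.2.1)) = ∑ p : P × P × P, l p * h p)
    (hz : ∀ p, l p ≠ 0 → orbitSumG h p = 0) :
    (∑ p : P × P × P, l p * h p) = 0 := by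
  have h6 := six_mul_sum_eq_sum_orbitG l h h12 h23 h13 hc hc'
  have h0' : (∑ p : P × P × P, l p * orbitSumG h p) = 0 := by
    refine Finset.sum_eq_zero fun p _ => ?_
    by_cases hp : l p = 0
    · rw [hp, zero_mul]
    · rw [hz p hp, mul_zero]
  rw [← h6] at h0'
  rcases mul_eq_zero.mp h0' with h | h
  · norm_num at h
  · exact h

end Abstract

/-! ## The inert factor is positive -/

section Inert

variable {E : Type*} [Fintype E] [DecidableEq E] {R : Type*} [Field R] [LinearOrder R]
  [IsStrictOrderedRing R]

/-- A typed set with `τ ≤ 3` has a typed colouring: the constant count is positive. -/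
lemma typedCount_one_pos (C : Finset E) (z : Config E) (τ : E → ℕ) (hτ : ∀ e ∈ C, τ e ≤ 3) :
    0 < typedCount C z τ (fun _ _ _ => (1 : R)) := by
  classical
  let x₀ : Config E := fun e => if e ∈ C then decide (1 ≤ τ e) else z e
  let y₀ : Config E := fun e => if e ∈ C then decide (2 ≤ τ e) else z e
  let w₀ : Config E := fun e => if e ∈ C then decide (3 ≤ τ e) else z e
  have hcond : (∀ e, e ∉ C → x₀ e = z e ∧ y₀ e = z e ∧ w₀ e = z e) ∧
      (∀ e ∈ C, openCount x₀ y₀ w₀ e = τ e) := by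
    refine ⟨fun e he => ?_, fun e he => ?_⟩
    · simp only [x₀, y₀, w₀, if_neg he, and_self]
    · have h3 := hτ e he
      simp only [openCount, x₀, y₀, w₀, if_pos he]
      interval_cases (τ e) <;> simp
  have hnn : ∀ x y w : Config E, (0 : R) ≤
      (if (∀ e, e ∉ C → x e = z e ∧ y e = z e ∧ w e = z e) ∧ (∀ e ∈ C, openCount x y w e = τ e)
        then (1 : R) else 0) := by
    intro x y w
    split_ifs <;> norm_num
  unfold typedCount
  have h1 : (if (∀ e, e ∉ C → x₀ e = z e ∧ y₀ e = z e ∧ w₀ e = z e) ∧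
      (∀ e ∈ C, openCount x₀ y₀ w₀ e = τ e) then (1 : R) else 0) ≤
      ∑ w : Config E, (if (∀ e, e ∉ C → x₀ e = z e ∧ y₀ e = z e ∧ w e = z e) ∧
        (∀ e ∈ C, openCount x₀ y₀ w e = τ e) then (1 : R) else 0) :=
    Finset.single_le_sum (fun w _ => hnn x₀ y₀ w) (Finset.mem_univ w₀)
  have h2 : (∑ w : Config E, (if (∀ e, e ∉ C → x₀ e = z e ∧ y₀ e = z e ∧ w e = z e) ∧
        (∀ e ∈ C, openCount x₀ y₀ w e = τ e) then (1 : R) else 0)) ≤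
      ∑ y : Config E, ∑ w : Config E, (if (∀ e, e ∉ C → x₀ e = z e ∧ y e = z e ∧ w e = z e) ∧
        (∀ e ∈ C, openCount x₀ y w e = τ e) then (1 : R) else 0) :=
    Finset.single_le_sum (fun y _ => Finset.sum_nonneg fun w _ => hnn x₀ y w)
      (Finset.mem_univ y₀)
  have h3 : (∑ y : Config E, ∑ w : Config E, (if (∀ e, e ∉ C → x₀ e = z e ∧ y e = z e ∧
        w e = z e) ∧ (∀ e ∈ C, openCount x₀ y w e = τ e) then (1 : R) else 0)) ≤
      ∑ x : Config E, ∑ y : Config E, ∑ w : Config E,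
        (if (∀ e, e ∉ C → x e = z e ∧ y e = z e ∧ w e = z e) ∧
          (∀ e ∈ C, openCount x y w e = τ e) then (1 : R) else 0) :=
    Finset.single_le_sum
      (fun x _ => Finset.sum_nonneg fun y _ => Finset.sum_nonneg fun w _ => hnn x y w)
      (Finset.mem_univ x₀)
  rw [if_pos hcond] at h1
  exact lt_of_lt_of_le zero_lt_one (h1.trans (h2.trans h3))

end Inert

/-! ## The equality locus at a split -/

section Locus

open Classical

variable {V : Type*} {E : Type*} {ι : Type*} [Fintype E] [DecidableEq E] [Fintype ι]
  [DecidableEq ι] {R : Type*} [Field R] [LinearOrder R] [IsStrictOrderedRing R]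
variable (ends : E → Sym2 V) (mk : Fin 5 → V) (σ : ι → V)

/-- **THE EQUALITY LOCUS OF ROW 2′TRI AT A SPLIT**: under the rule's hypothesis (the realised
`S₃`-orbit sums of the glued root counts nonnegative), the typed count vanishes exactly when every
realised orbit sum vanishes. -/
theorem typedCount_eq_zero_iff_of_sepSplit {side : Fin 5 → Bool} {VL VH : Set V} (F : Finset E)
    (z : Config E) (τ : E → ℕ) (hτ : ∀ e ∈ F, τ e = 1 ∨ τ e = 2)
    (h : SepSplit ends mk σ side VL VH F z)
    (hroot : ∀ p : Pat3S ι,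
      typedCount (sideF ends VL F) z τ
          (farKS ends mk σ VL p : Config E → Config E → Config E → R) ≠ 0 →
      (0 : R) ≤ orbitRootS ends mk σ side VH (sideF ends VH F) z τ p) :
    typedCount F z τ
        (K3 ends (mk 0) (mk 1) (mk 2) (mk 3) (mk 4) : Config E → Config E → Config E → R) = 0 ↔
      ∀ p : Pat3S ι,
        typedCount (sideF ends VL F) z τ
            (farKS ends mk σ VL p : Config E → Config E → Config E → R) ≠ 0 →
          orbitRootS ends mk σ side VH (sideF ends VH F) z τ p = (0 : R) := by
  rw [typedCount_eq_sepSplit ends mk σ F z τ h]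
  have hτA : ∀ e ∈ sideF ends VL F, τ e = 1 ∨ τ e = 2 :=
    fun e he => hτ e (Finset.filter_subset _ _ he)
  have hC : typedCount (F \ (sideF ends VL F ∪ sideF ends VH F)) z τ
      (fun _ _ _ => (1 : R)) ≠ 0 := by
    refine ne_of_gt (typedCount_one_pos _ z τ fun e he => ?_)
    rcases hτ e (Finset.mem_sdiff.mp he).1 with h1 | h1 <;> omega
  rw [mul_eq_zero, or_iff_left hC]
  refine sum_eq_zero_iff_of_orbit_sumsG
    (fun p => typedCount (sideF ends VL F) z τ (farKS ends mk σ VL p))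
    (fun p => typedCount (sideF ends VH F) z τ (rootKS ends mk σ side VH p))
    (fun p => farCountS_nonneg ends mk σ VL _ z τ p) ?_ ?_ ?_ ?_ ?_ hroot
  · exact sum_far_root_permS ends mk σ side VL VH _ _ z τ _
      (Function.Involutive.bijective fun _ => rfl)
      (fun p => farCountS_swap12 ends mk σ VL _ z τ p)
  · exact sum_far_root_permS ends mk σ side VL VH _ _ z τ _
      (Function.Involutive.bijective fun _ => rfl)
      (fun p => farCountS_swap23 ends mk σ VL _ z τ hτA p)
  · exact sum_far_root_permS ends mk σ side VL VH _ _ z τ _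
      (Function.Involutive.bijective fun _ => rfl)
      (fun p => farCountS_swap13 ends mk σ VL _ z τ hτA p)
  · exact sum_far_root_permS ends mk σ side VL VH _ _ z τ _
      (Function.bijective_iff_has_inverse.mpr
        ⟨fun p => (p.2.2, p.1, p.2.1), fun _ => rfl, fun _ => rfl⟩)
      (fun p => farCountS_cyc ends mk σ VL _ z τ hτA p)
  · exact sum_far_root_permS ends mk σ side VL VH _ _ z τ _
      (Function.bijective_iff_has_inverse.mpr
        ⟨fun p => (p.2.1, p.2.2, p.1), fun _ => rfl, fun _ => rfl⟩)
      (fun p => farCountS_cyc' ends mk σ VL _ z τ hτA p)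

/-- **Vanishing without a sign hypothesis**: if every realised orbit sum of the glued root counts
vanishes, the typed count vanishes. -/
theorem typedCount_eq_zero_of_sepSplit_realised_zero {side : Fin 5 → Bool} {VL VH : Set V}
    (F : Finset E) (z : Config E) (τ : E → ℕ) (hτ : ∀ e ∈ F, τ e = 1 ∨ τ e = 2)
    (h : SepSplit ends mk σ side VL VH F z)
    (hzero : ∀ p : Pat3S ι,
      typedCount (sideF ends VL F) z τ
          (farKS ends mk σ VL p : Config E → Config E → Config E → R) ≠ 0 →
      orbitRootS ends mk σ side VH (sideF ends VH F) z τ p = (0 : R)) :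
    typedCount F z τ
      (K3 ends (mk 0) (mk 1) (mk 2) (mk 3) (mk 4) : Config E → Config E → Config E → R) = 0 := by
  rw [typedCount_eq_sepSplit ends mk σ F z τ h]
  have hτA : ∀ e ∈ sideF ends VL F, τ e = 1 ∨ τ e = 2 :=
    fun e he => hτ e (Finset.filter_subset _ _ he)
  rw [sum_eq_zero_of_orbit_sums_zeroG
    (fun p => typedCount (sideF ends VL F) z τ (farKS ends mk σ VL p))
    (fun p => typedCount (sideF ends VH F) z τ (rootKS ends mk σ side VH p))
    (sum_far_root_permS ends mk σ side VL VH _ _ z τ _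
      (Function.Involutive.bijective fun _ => rfl)
      (fun p => farCountS_swap12 ends mk σ VL _ z τ p))
    (sum_far_root_permS ends mk σ side VL VH _ _ z τ _
      (Function.Involutive.bijective fun _ => rfl)
      (fun p => farCountS_swap23 ends mk σ VL _ z τ hτA p))
    (sum_far_root_permS ends mk σ side VL VH _ _ z τ _
      (Function.Involutive.bijective fun _ => rfl)
      (fun p => farCountS_swap13 ends mk σ VL _ z τ hτA p))
    (sum_far_root_permS ends mk σ side VL VH _ _ z τ _
      (Function.bijective_iff_has_inverse.mpr
        ⟨fun p => (p.2.2, p.1, p.2.1), fun _ => rfl, fun _ => rfl⟩)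
      (fun p => farCountS_cyc ends mk σ VL _ z τ hτA p))
    (sum_far_root_permS ends mk σ side VL VH _ _ z τ _
      (Function.bijective_iff_has_inverse.mpr
        ⟨fun p => (p.2.1, p.2.2, p.1), fun _ => rfl, fun _ => rfl⟩)
      (fun p => farCountS_cyc' ends mk σ VL _ z τ hτA p))
    hzero, zero_mul]

end Locus

end RootBridge

end CovForm

end Summit.Ventures.PercRepro2
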